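import Literature.Computability.Complexity.PEADegreeReduction

/-!
# PneNP / SzkEntropy — `PeaDegreeReduction` (stmt-PneNP-10780), cycle-free restatement of the proof

Route `PneNP/SzkEntropy`, support item stmt-PneNP-10780 (`PeaDegreeReduction`): for every degree
bound `d`, `PEA_d` Karp-reduces to `PEA_3` (`PromiseProblem.PolyTimeReducible`).  PROVED in the
tree by the Literature theorem `Literature.Computability.Complexity.PEA_polyTimeReducible_PEA_three`
(degree reduction by perfect degree-3 randomizing polynomials, files `RandomizingPolynomials*.lean`,
`DegreeThreeEncoding*.lean`, `PEADegreeReduction.lean`), and the item was closed by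
`Summit.PneNP.PneNP.Theorems.szkEntropy_peaDegreeReduction_proof`
(`Theorems/SzkEntropyPeaDegreeReduction.lean`).

That closing module, however, `import`s the route file `Summits.PneNP.PneNP.Theses.SzkEntropy`,
and the gate links a proved item by importing the proving module INTO the route file
(`theorem PeaDegreeReduction_holds : PeaDegreeReduction := …`): the re-rendered route file then
imports itself transitively and every route decl is reported "already declared" (the rev-2 → rev-3
incident of items 13908–13910; reproduced for rev 4 with `ledger route check --native` on
2026-08-16).  This file re-proves the item from a module that imports NOTHING under `Summits/`:
the statement is the body of the route decl written out structurally (it is definitionally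
`∀ d, (Literature.Computability.Complexity.PEA d).PolyTimeReducible (PEA 3)`), so the gate /
planner can point the `_holds` link at `szkEntropy_peaDegreeReduction_standalone` and import this
module into the route file without a cycle (pattern of `SzkEntropyPeaMemPH.lean`,
`SzkEntropyPhCollapseStandalone.lean`, `SzkEntropyAssemblyStandalone.lean`).

References: Z. Dvir, D. Gutfreund, G. N. Rothblum, S. Vadhan, *On approximating the entropy of
polynomial mappings*, ECCC TR10-160 / ICS 2011, Thm 4.5 and Claim 4.4; Y. Ishai, E. Kushilevitz,
ICALP 2002, §3; B. Applebaum, Y. Ishai, E. Kushilevitz, SIAM J. Comput. 36 (2006), §4;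
O. Goldreich, *On promise problems* (2006), Def. 1.4.
-/

namespace Summit.PneNP.PneNP.Theorems

/-- **`PeaDegreeReduction` holds** (route `SzkEntropy`, item stmt-PneNP-10780), stated
structurally — the body of the route decl, `let ev/H/PEA := …; ∀ d, (PEA d).PolyTimeReducible
(PEA 3)` — and proved WITHOUT importing the route file, by the Literature degree-reduction theorem
`PEA_polyTimeReducible_PEA_three` (perfect degree-3 randomizing polynomials:
`H(P'(U_{n+m})) = H(P(U_n)) + m`, `deg P' ≤ 3`, instance map in `FP`).
[DvirGutfreundRothblumVadhan2010, Thm 4.5 and Claim 4.4; IshaiKushilevitz2002, §3;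
ApplebaumIshaiKushilevitz2006, §4] -/
theorem szkEntropy_peaDegreeReduction_standalone :
    (let ev : (n : ℕ) → List (List (List (Fin n))) → (Fin n → ZMod 2) → List (ZMod 2) := fun _ P x => P.map fun p => (p.map fun μ => (μ.map x).prod).sum; let H : (Σ n : ℕ, List (List (List (Fin n))) × ℕ) → ℝ := fun I => (∑ x : Fin I.1 → ZMod 2, Real.logb 2 (((Finset.univ : Finset (Fin I.1 → ZMod 2)).card : ℝ) / (Finset.univ.filter fun x' : Fin I.1 → ZMod 2 => ev I.1 I.2.1 x' = ev I.1 I.2.1 x).card)) / (Finset.univ : Finset (Fin I.1 → ZMod 2)).card; let PEA : ℕ → Literature.Computability.Complexity.PromiseProblem := fun d => Literature.Computability.Complexity.PromiseProblem.ofEncoding (Computability.Encoding.sigmaBool fun n => ((Literature.Computability.Complexity.encodingFinBool n).listBool.listBool.listBool).pairBool Computability.encodingNatBool) {I : (Σ n : ℕ, List (List (List (Fin n))) × ℕ) | (∀ p ∈ I.2.1, ∀ μ ∈ p, μ.length ≤ d) ∧ (I.2.2 : ℝ) + 1 ≤ H I} {I : (Σ n : ℕ, List (List (List (Fin n))) ×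 ℕ) | (∀ p ∈ I.2.1, ∀ μ ∈ p, μ.length ≤ d) ∧ H I ≤ (I.2.2 : ℝ)}; ∀ d : ℕ, (PEA d).PolyTimeReducible (PEA 3)) :=
  fun d => Literature.Computability.Complexity.PEA_polyTimeReducible_PEA_three d

end Summit.PneNP.PneNP.Theorems
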